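import Literature.AnabelianGeometry.EtaleTheta.SettingModelChiMuTwo
import Literature.AnabelianGeometry.EtaleTheta.SettingModelChiAnchoredPoints
import Literature.AnabelianGeometry.EtaleTheta.SettingModelChiProp15ii
import Literature.AnabelianGeometry.EtaleTheta.SettingModelChiThetaCocycle
import Literature.AnabelianGeometry.EtaleTheta.StandardDataModelNonVacuity
import Literature.AnabelianGeometry.EtaleTheta.Discharge.Sec1Thm110MatchingReflNV
import HarnessLib

/-!
# [EtTh] Def. 1.9 / Thm. 1.10 (i)(ii) at the χ-twisted model: ANCHORED STANDARD DATA at `MuTwoSetting.modelχ` and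
# the K2 closers INHABITED at a named Kummer-carrying datum (non-vacuity of F-0512 / F-0514's instance forms)

S. Mochizuki, *The étale theta function and its Frobenioid-theoretic manifestations*, Publ. RIMS **45** (2009) [EtTh],
§1: Def. 1.9 p. 29 (PRIMS p. 255: "suppose that `√−1 ∈ K`"; "`√−1` determines a 4-torsion point `τ` … the 4-torsion
point `τ⁻¹` determined by `−√−1`", "`Ü(τ) = √−1`"), Thm. 1.10 (i)(ii) pp. 29–30 (constant multiple rigidity)
[cite: MochizukiEtTh2009, Def 1.9 p.29]. Layer L2 of the abc-iut cell, seat abc-iut-w5-d140 (gen 4; K2 holder lineage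
SUBDAG EtTh:Thm1.10 — row «K2-NV@modelχ» agreed with abc-iut-f-113 g3, STATUS 10:44:04Z). PROOF-ONLY over:
abc-iut-f-113's F8 `MuTwoSetting.modelχ p` (`SettingModelChiMuTwo`: the Def. 1.7 layer over the χ-twisted root
`ThetaSetting.modelχ p`, `K = K̈ = ℚ_p`, `q̈ = p`, admissible `ε_Z := a` = `epsZχ`), abc-iut-L2-t6's F7b
`kummerDataχSec` / `etaleThetaDataχSec` / **`anchoredPointχ u hu`** (`SettingModelChiSectionPoints`,
`SettingModelChiAnchoredPoints`: the ANCHORED `K̈`-point of `Ÿ` at the `κ_u²`-twisted Galois section, `Ü(y) = u`,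
`log(Ü)|_y = u`), abc-iut-L6-d5's `prop15ii_kummerDataχSec` (Prop. 1.5 (ii) HOLDS at the section datum), abc-iut-L2-d1's
theta class `etaDdχ`, abc-iut-w5-d008's `Padic.exists_sq_eq_neg_one` (`√−1 ∈ ℚ_p ⟺ p ≡ 1 (mod 4)`), and this lineage's
K2 closers `MuTwoSetting.thm110i_and_ii_refl` / `thm110i_inputs_refl` (`Discharge/Sec1Thm110MatchingReflNV`,
p429827) — all consumed BY NAME; no definition of another seat is edited or restated.

WHAT.
* `sqrtNegOneχ hp := √−1 ∈ ℚ_p ⊆ ℚ̄_p` for `p ≡ 1 (mod 4)`; `sqrtNegOneUnitχ hp`, `sqrtNegOneInvUnitχ hp : K̈^×` the units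
  `√−1`, `(√−1)⁻¹ = −√−1` of the χ-model; `ne_cusp_of_sq_eq_neg_one`: a square root of `−1` is OFF the cusps `±q̈^ℤ = ±p^ℤ`
  (norms force the exponent `0`, and `(±1)² ≠ −1` in characteristic `0`).
* **`anchoredStandardDataχSec hp : (MuTwoSetting.modelχ p).AnchoredStandardData (kummerDataχSec p)`** (and
  `anchoredStandardDataχ hp η`, the same datum over `(etaleThetaDataχSec p η).toKummerData`, unfolded once) — Def. 1.9's
  `τ := anchoredPointχ (√−1)`, `τ⁻¹ := anchoredPointχ (√−1)⁻¹` (abc-iut-L2-t1's ANCHORED refinement of `StandardData`: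
  `evalAt` injective and `log(Ü)|_τ = Ü(τ)`), packaged by abc-iut-L2-t6's `anchoredStandardDataOfPoints`. So the
  census row «`AnchoredStandardData` / `StandardData` → WITNESSED at a Kummer-carrying model» holds for `p ≡ 1 (4)`
  (`nonempty_anchoredStandardData_modelχ`), and FAILS for `p ≢ 1 (4)` for the printed reason "`√−1 ∈ K`"
  (`isEmpty_standardData_modelχ`, as abc-iut-w5-d008's `isEmpty_standardData_model` at the root).
* **K2 NON-VACUITY** (`modelχ_thm110i_and_ii`, `MuTwoSetting.exists_kummer_model_thm110i_and_ii`): at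
  `M := MuTwoSetting.modelχ p`, `p ≡ 1 (4)`, with `E := etaleThetaDataχSec p η` (ANY class `η̈` playing `η̈^Θ`, e.g.
  abc-iut-L2-d1's genuine theta class `etaDdχ p`), `A := anchoredStandardDataχ hp`, `hC := ThetaSetting.compat`,
  `h15ii := prop15ii_kummerDataχSec` and `γ := id`: **there is `H : Thm110Hypothesis ε_Z ε_Z hC hC E E (refl)` with
  `Thm110i H A A ∧ Thm110ii H A A`** — i.e. the instance forms of FACT-LIST F-0512 (`Thm110i`) and F-0514 (`Thm110ii`)
  are INHABITED at a NAMED datum carrying a genuine Kummer structure, anchored points and Prop. 1.5 (ii) as a THEOREM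
  (at the discrete root every such statement was vacuous: `KummerData` empty, abc-iut-w5-d171). Also the K2 INPUT
  rows are inhabited there (`modelχ_thm110i_inputs`: `Thm110DeltaInduced H δ`, `Thm110DeltaCompat δ` and the r5-type
  matching of decomposition groups, at `γ = id`).
NOT CLAIMED: `Thm110iUnique` (F-0513) — its route r8″ needs `Prop15iii`, EXPECTED-FALSE at this stage-1 model
(abc-iut-L2-t12 `Discharge/Sec1Prop15iiiForcesShear`); the ∀-closure TESTS of F-0512/0513/0514 are abc-iut-f-113's row.

HONEST FRAMING: SEMI-SYNTHETIC model (the χ-twisted root; not the tempered `π₁` of a curve) — non-vacuity /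
consistency evidence for the typed interface ONLY; `γ = id` is the trivial instance of Thm. 1.10's isomorphism; the
values of `η̈^Θ` at the section-points are not the printed `Θ̈(√−1)`; nothing of [EtTh] is asserted; a FACT row is an
assumption label; typed ≠ proved; no side is taken on [IUTchIII] Cor. 3.12. Definitions here: `sqrtNegOneχ`,
`sqrtNegOneUnitχ`, `sqrtNegOneInvUnitχ`, `tauχ`, `tauInvχ`, `anchoredStandardDataχSec`, `anchoredStandardDataχ` (constructions of
FROZEN records, class (b); no instance, no `Prop` fact).
-/

noncomputable section

namespace Literature.AnabelianGeometry.EtaleTheta.SettingModel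

open Literature.AnabelianGeometry.SemiGraphs _root_.Topology _root_.Function

variable (p : ℕ) [Fact p.Prime]

/-! ### `√−1 ∈ K = ℚ_p` for `p ≡ 1 (mod 4)` -/

/-- **`√−1 ∈ ℚ_p ⊆ ℚ̄_p`** for `p ≡ 1 (mod 4)` (abc-iut-w5-d008's `Padic.exists_sq_eq_neg_one`, Hensel). DEFINED (a choice).
[cite: MochizukiEtTh2009, Def 1.9 p.29] -/
def sqrtNegOneχ (hp : p % 4 = 1) : PadicAlgCl p :=
  algebraMap ℚ_[p] (PadicAlgCl p) (Padic.exists_sq_eq_neg_one hp).choose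

/-- `(√−1)² = −1`. [cite: MochizukiEtTh2009, Def 1.9 p.29] -/
theorem sqrtNegOneχ_sq (hp : p % 4 = 1) : sqrtNegOneχ p hp ^ 2 = -1 := by
  rw [sqrtNegOneχ, ← map_pow, (Padic.exists_sq_eq_neg_one hp).choose_spec, map_neg, map_one]

/-- `√−1 ∈ K` for the χ-model (`K = ℚ_p`; any intermediate field contains `ℚ_p`). [cite: MochizukiEtTh2009, Def 1.9 p.29] -/
theorem sqrtNegOneχ_mem_K (hp : p % 4 = 1) : sqrtNegOneχ p hp ∈ (ThetaSetting.modelχ p).K :=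
  IntermediateField.algebraMap_mem _ _

/-- `√−1 ∈ K̈`. [cite: MochizukiEtTh2009, Def 1.9 p.29] -/
theorem sqrtNegOneχ_mem_Kdd (hp : p % 4 = 1) : sqrtNegOneχ p hp ∈ (ThetaSetting.modelχ p).Kdd :=
  IntermediateField.algebraMap_mem _ _

/-- `√−1 ≠ 0`. [cite: MochizukiEtTh2009, Def 1.9 p.29] -/
theorem sqrtNegOneχ_ne_zero (hp : p % 4 = 1) : sqrtNegOneχ p hp ≠ 0 := fun h => by
  have h2 := sqrtNegOneχ_sq p hp
  rw [h, zero_pow two_ne_zero] at h2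
  exact one_ne_zero (neg_eq_zero.mp h2.symm)

/-- `((√−1)⁻¹)² = −1`. [cite: MochizukiEtTh2009, Def 1.9 p.29] -/
theorem sqrtNegOneχ_inv_sq (hp : p % 4 = 1) : (sqrtNegOneχ p hp)⁻¹ ^ 2 = -1 := by
  rw [inv_pow, sqrtNegOneχ_sq, inv_neg, inv_one]

/-- **A square root of `−1` is off the cusps `±q̈^ℤ = ±p^ℤ`** of the χ-model: `‖x‖ = 1` forces the exponent `0`, and
`x = ±1` contradicts `x² = −1` in characteristic `0`. [cite: MochizukiEtTh2009, Prop 1.4 (i) p.21] -/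
theorem ne_cusp_of_sq_eq_neg_one {x : PadicAlgCl p} (hx : x ^ 2 = -1) (a : ℤ) :
    x ≠ (ThetaSetting.modelχ p).qdd ^ a ∧ x ≠ -((ThetaSetting.modelχ p).qdd ^ a) := by
  change x ≠ ((p : ℕ) : PadicAlgCl p) ^ a ∧ x ≠ -(((p : ℕ) : PadicAlgCl p) ^ a)
  have hp1 : ‖(p : PadicAlgCl p)‖ < 1 := by
    rw [← map_natCast (algebraMap ℚ_[p] (PadicAlgCl p)) p, PadicAlgCl.norm_extends]
    exact Padic.norm_p_lt_one
  have hxn : ‖x‖ = 1 := by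
    have h : ‖x‖ ^ 2 = 1 := by rw [← norm_pow, hx, norm_neg, norm_one]
    exact (pow_eq_one_iff_of_nonneg (norm_nonneg x) two_ne_zero).mp h
  -- a power of `p` of norm `1` is `p⁰`
  have hzero : ‖((p : ℕ) : PadicAlgCl p) ^ a‖ = 1 → a = 0 := fun h => by
    rw [norm_zpow] at h
    exact (zpow_eq_one_iff_right₀ (norm_nonneg _) hp1.ne).mp h
  -- `(±1)² ≠ −1`
  have hone : x ≠ 1 ∧ x ≠ -1 := by
    constructor <;> intro h <;> rw [h] at hx <;> norm_num at hx
  constructor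
  · intro h
    have hn : ‖((p : ℕ) : PadicAlgCl p) ^ a‖ = 1 := by rw [← h]; exact hxn
    rw [hzero hn, zpow_zero] at h
    exact hone.1 h
  · intro h
    have hn : ‖((p : ℕ) : PadicAlgCl p) ^ a‖ = 1 := by rw [← norm_neg, ← h]; exact hxn
    rw [hzero hn, zpow_zero] at h
    exact hone.2 h

/-- **The unit `√−1 ∈ K̈^×`** of the χ-model. DEFINED. [cite: MochizukiEtTh2009, Def 1.9 p.29] -/
def sqrtNegOneUnitχ (hp : p % 4 = 1) : (↥(ThetaSetting.modelχ p).Kdd)ˣ :=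
  Units.mk0 ⟨sqrtNegOneχ p hp, sqrtNegOneχ_mem_Kdd p hp⟩ fun h => sqrtNegOneχ_ne_zero p hp (congrArg Subtype.val h)

/-- **The unit `(√−1)⁻¹ = −√−1 ∈ K̈^×`**. DEFINED. [cite: MochizukiEtTh2009, Def 1.9 p.29] -/
def sqrtNegOneInvUnitχ (hp : p % 4 = 1) : (↥(ThetaSetting.modelχ p).Kdd)ˣ :=
  Units.mk0 ⟨(sqrtNegOneχ p hp)⁻¹, inv_mem (sqrtNegOneχ_mem_Kdd p hp)⟩ fun h =>
    inv_ne_zero (sqrtNegOneχ_ne_zero p hp) (congrArg Subtype.val h)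

/-- [cite: MochizukiEtTh2009, Def 1.9 p.29] -/
@[simp] theorem coe_sqrtNegOneUnitχ (hp : p % 4 = 1) :
    ((sqrtNegOneUnitχ p hp : (ThetaSetting.modelχ p).Kdd) : PadicAlgCl p) = sqrtNegOneχ p hp := rfl

/-- [cite: MochizukiEtTh2009, Def 1.9 p.29] -/
@[simp] theorem coe_sqrtNegOneInvUnitχ (hp : p % 4 = 1) :
    ((sqrtNegOneInvUnitχ p hp : (ThetaSetting.modelχ p).Kdd) : PadicAlgCl p) = (sqrtNegOneχ p hp)⁻¹ := rfl

/-- `√−1` is off the cusps (as a unit of `K̈`). [cite: MochizukiEtTh2009, Def 1.9 p.29] -/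
theorem sqrtNegOneUnitχ_ne_cusp (hp : p % 4 = 1) (a : ℤ) :
    ((sqrtNegOneUnitχ p hp : (ThetaSetting.modelχ p).Kdd) : PadicAlgCl p) ≠ (ThetaSetting.modelχ p).qdd ^ a ∧
      ((sqrtNegOneUnitχ p hp : (ThetaSetting.modelχ p).Kdd) : PadicAlgCl p) ≠ -((ThetaSetting.modelχ p).qdd ^ a) :=
  ne_cusp_of_sq_eq_neg_one p (sqrtNegOneχ_sq p hp) a

/-- `(√−1)⁻¹` is off the cusps. [cite: MochizukiEtTh2009, Def 1.9 p.29] -/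
theorem sqrtNegOneInvUnitχ_ne_cusp (hp : p % 4 = 1) (a : ℤ) :
    ((sqrtNegOneInvUnitχ p hp : (ThetaSetting.modelχ p).Kdd) : PadicAlgCl p) ≠ (ThetaSetting.modelχ p).qdd ^ a ∧
      ((sqrtNegOneInvUnitχ p hp : (ThetaSetting.modelχ p).Kdd) : PadicAlgCl p) ≠ -((ThetaSetting.modelχ p).qdd ^ a) :=
  ne_cusp_of_sq_eq_neg_one p (sqrtNegOneχ_inv_sq p hp) a

/-! ### Def. 1.9 at `modelχ`: the anchored points `τ`, `τ⁻¹` and the anchored standard datum -/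

/-- **`τ := anchoredPointχ (√−1)`**: the anchored `K̈`-point of `Ÿ` at the `κ_{√−1}²`-twisted section, `Ü(τ) = √−1`.
[cite: MochizukiEtTh2009, Def 1.9 p.29] -/
abbrev tauχ (hp : p % 4 = 1) : ThetaSetting.AnchoredPoint (kummerDataχSec p) :=
  anchoredPointχ p (sqrtNegOneUnitχ p hp) (sqrtNegOneUnitχ_ne_cusp p hp)

/-- **`τ⁻¹ := anchoredPointχ (√−1)⁻¹`**, `Ü(τ⁻¹) = (√−1)⁻¹ = −√−1`. [cite: MochizukiEtTh2009, Def 1.9 p.29] -/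
abbrev tauInvχ (hp : p % 4 = 1) : ThetaSetting.AnchoredPoint (kummerDataχSec p) :=
  anchoredPointχ p (sqrtNegOneInvUnitχ p hp) (sqrtNegOneInvUnitχ_ne_cusp p hp)

/-- **Def. 1.9's anchored standard datum at `MuTwoSetting.modelχ`** (`p ≡ 1 (mod 4)`): `√−1 ∈ K = ℚ_p`,
`τ := anchoredPointχ (√−1)`, `τ⁻¹ := anchoredPointχ (√−1)⁻¹`, over the section Kummer datum `kummerDataχSec`.
DEFINED (abc-iut-L2-t6's `anchoredStandardDataOfPoints`). [cite: MochizukiEtTh2009, Def 1.9 p.29] -/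
def anchoredStandardDataχSec (hp : p % 4 = 1) : (MuTwoSetting.modelχ p).AnchoredStandardData (kummerDataχSec p) :=
  MuTwoSetting.anchoredStandardDataOfPoints (sqrtNegOneχ p hp) (sqrtNegOneχ_mem_K p hp) (sqrtNegOneχ_sq p hp)
    (tauχ p hp) (tauInvχ p hp) rfl rfl

/-- [cite: MochizukiEtTh2009, Def 1.9 p.29] -/
@[simp] theorem anchoredStandardDataχSec_tau (hp : p % 4 = 1) : (anchoredStandardDataχSec p hp).tau = tauχ p hp := rfl

/-- [cite: MochizukiEtTh2009, Def 1.9 p.29] -/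
@[simp] theorem anchoredStandardDataχSec_tauInv (hp : p % 4 = 1) :
    (anchoredStandardDataχSec p hp).tauInv = tauInvχ p hp := rfl

/-- [cite: MochizukiEtTh2009, Def 1.9 p.29] -/
@[simp] theorem anchoredStandardDataχSec_sqrtNegOne (hp : p % 4 = 1) :
    (anchoredStandardDataχSec p hp).sqrtNegOne = sqrtNegOneχ p hp := rfl

/-- **The same datum read over the Kummer datum of abc-iut-L2-t6's `EtaleThetaData` `etaleThetaDataχSec p η`** (any
class `η̈` playing `η̈^Θ`; its `toKummerData` IS `kummerDataχSec p` — the two definitions are unfolded once here so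
that no consumer pays for the identification). DEFINED. [cite: MochizukiEtTh2009, Def 1.9 p.29] -/
def anchoredStandardDataχ (hp : p % 4 = 1) (η : (ThetaSetting.modelχ p).H1 (ThetaSetting.modelχ p).GtpYdd) :
    (MuTwoSetting.modelχ p).AnchoredStandardData (etaleThetaDataχSec p η).toKummerData := by
  delta etaleThetaDataχSec ThetaSetting.KummerData.etaleThetaDataOfClass
  exact anchoredStandardDataχSec p hp

/-- Its `√−1` is `sqrtNegOneχ`. [cite: MochizukiEtTh2009, Def 1.9 p.29] -/
@[simp] theorem anchoredStandardDataχ_sqrtNegOne (hp : p % 4 = 1)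
    (η : (ThetaSetting.modelχ p).H1 (ThetaSetting.modelχ p).GtpYdd) :
    (anchoredStandardDataχ p hp η).sqrtNegOne = sqrtNegOneχ p hp := rfl

/-- Its `τ` has decomposition group `s_{√−1}(G_{ℚ_p})` and coordinate `√−1`. [cite: MochizukiEtTh2009, Def 1.9 p.29] -/
theorem anchoredStandardDataχ_tau_Dpt (hp : p % 4 = 1) (η : (ThetaSetting.modelχ p).H1 (ThetaSetting.modelχ p).GtpYdd) :
    (anchoredStandardDataχ p hp η).tau.Dpt =
      (ThetaSetting.modelχ p).GKdd.map (sectionOfUnitχ p (sqrtNegOneUnitχ p hp)) := rfl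

/-- Its `τ⁻¹` has decomposition group `s_{(√−1)⁻¹}(G_{ℚ_p})`. [cite: MochizukiEtTh2009, Def 1.9 p.29] -/
theorem anchoredStandardDataχ_tauInv_Dpt (hp : p % 4 = 1)
    (η : (ThetaSetting.modelχ p).H1 (ThetaSetting.modelχ p).GtpYdd) :
    (anchoredStandardDataχ p hp η).tauInv.Dpt =
      (ThetaSetting.modelχ p).GKdd.map (sectionOfUnitχ p (sqrtNegOneInvUnitχ p hp)) := rfl

/-- `Prop15ii` of the `EtaleThetaData`'s Kummer datum (abc-iut-L6-d5's theorem, read through the same unfolding).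
[cite: MochizukiEtTh2009, Prop 1.5 (ii) p.23] -/
theorem prop15ii_etaleThetaDataχSec (η : (ThetaSetting.modelχ p).H1 (ThetaSetting.modelχ p).GtpYdd) :
    ThetaSetting.Prop15ii (etaleThetaDataχSec p η).toKummerData (MuTwoSetting.modelχ_compat p) := by
  delta etaleThetaDataχSec ThetaSetting.KummerData.etaleThetaDataOfClass
  exact prop15ii_kummerDataχSec p _

/-- `D_τ = s_{√−1}(G_{ℚ_p})`, the `κ_{√−1}²`-twisted Galois section. [cite: MochizukiEtTh2009, Def 1.9 p.29] -/
theorem Dpt_tauχ (hp : p % 4 = 1) :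
    (tauχ p hp).Dpt = (ThetaSetting.modelχ p).GKdd.map (sectionOfUnitχ p (sqrtNegOneUnitχ p hp)) := rfl

/-- `D_{τ⁻¹} = s_{(√−1)⁻¹}(G_{ℚ_p})`. [cite: MochizukiEtTh2009, Def 1.9 p.29] -/
theorem Dpt_tauInvχ (hp : p % 4 = 1) :
    (tauInvχ p hp).Dpt = (ThetaSetting.modelχ p).GKdd.map (sectionOfUnitχ p (sqrtNegOneInvUnitχ p hp)) := rfl

/-- **CENSUS: «`AnchoredStandardData` / `StandardData` → WITNESSED at a Kummer-carrying model» for `p ≡ 1 (mod 4)`.**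
[cite: MochizukiEtTh2009, Def 1.9 p.29] -/
theorem nonempty_anchoredStandardData_modelχ (hp : p % 4 = 1) :
    Nonempty ((MuTwoSetting.modelχ p).AnchoredStandardData (kummerDataχSec p)) ∧
      Nonempty ((MuTwoSetting.modelχ p).StandardData (kummerDataχSec p)) :=
  ⟨⟨anchoredStandardDataχSec p hp⟩, ⟨(anchoredStandardDataχSec p hp).toStandardData⟩⟩

/-- **… and EMPTY for `p ≢ 1 (mod 4)`**, for every Kummer datum `E` of the χ-model: the printed standing hypothesis
"suppose that `√−1 ∈ K`" fails for `K = ℚ_p` (abc-iut-w5-d008's `Padic.mod_four_eq_one_of_sq_eq_neg_one`). So every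
`∀ S : StandardData …` statement (Def. 1.9 (i)(ii), the Thm. 1.10 binders) is VACUOUS at `MuTwoSetting.modelχ p` for
such `p`. [cite: MochizukiEtTh2009, Def 1.9 p.29] -/
theorem isEmpty_standardData_modelχ (hp : p % 4 ≠ 1) (E : (ThetaSetting.modelχ p).KummerData) :
    IsEmpty ((MuTwoSetting.modelχ p).StandardData E) := by
  refine ⟨fun S => hp ?_⟩
  have hmem : S.sqrtNegOne ∈ (⊥ : IntermediateField ℚ_[p] (PadicAlgCl p)) := S.sqrtNegOne_mem
  rw [IntermediateField.mem_bot] at hmem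
  obtain ⟨x, hx⟩ := hmem
  have hx2 : x ^ 2 = -1 := by
    apply (algebraMap ℚ_[p] (PadicAlgCl p)).injective
    rw [map_pow, hx, S.sqrtNegOne_sq, map_neg, map_one]
  exact Padic.mod_four_eq_one_of_sq_eq_neg_one hx2

/-- The dichotomy in one line: `StandardData` over the section datum of the χ-model is inhabited iff `p ≡ 1 (mod 4)`.
[cite: MochizukiEtTh2009, Def 1.9 p.29] -/
theorem nonempty_standardData_modelχ_iff :
    Nonempty ((MuTwoSetting.modelχ p).StandardData (kummerDataχSec p)) ↔ p % 4 = 1 := by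
  constructor
  · intro ⟨S⟩
    by_contra h
    exact (isEmpty_standardData_modelχ p h (kummerDataχSec p)).false S
  · exact fun hp => (nonempty_anchoredStandardData_modelχ p hp).2

/-! ### Thm. 1.10 (i)(ii) at `modelχ`: the K2 closers are INHABITED -/

/-- abc-iut-L2-t6's `etaleThetaDataχSec p η` READ AS étale-theta data of the Def. 1.7 model `MuTwoSetting.modelχ p` (its
theta setting IS `ThetaSetting.modelχ p`; the identification is made once here). [cite: MochizukiEtTh2009, Prop 1.3 p.20] -/
abbrev etaleThetaDataχM (η : (ThetaSetting.modelχ p).H1 (ThetaSetting.modelχ p).GtpYdd) :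
    (MuTwoSetting.modelχ p).toThetaSetting.EtaleThetaData :=
  etaleThetaDataχSec p η


/-- **The K2 INPUT rows at the χ-model** (`γ = id`, `p ≡ 1 (4)`, any class `η̈`): there are
`H : Thm110Hypothesis ε_Z ε_Z hC hC E E (refl)` and `δ` with `Thm110DeltaInduced H δ`, `Thm110DeltaCompat δ`, and the
r5-type matching of the decomposition groups of `τ^{±1}` under `γ_X` (this lineage's `thm110i_inputs_refl`, p429827).
[cite: MochizukiEtTh2009, Thm 1.10 p.29] -/
theorem modelχ_thm110i_inputs (hp : p % 4 = 1)
    (η : (ThetaSetting.modelχ p).H1 (ThetaSetting.modelχ p).GtpYdd) :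
    ∃ (H : Thm110Hypothesis (Mα := MuTwoSetting.modelχ p) (Mβ := MuTwoSetting.modelχ p) (epsZχ p) (epsZχ p)
        (MuTwoSetting.modelχ_compat p) (MuTwoSetting.modelχ_compat p)
        (etaleThetaDataχM p η) (etaleThetaDataχM p η) (ContinuousMulEquiv.refl _))
      (δ : (↥(MuTwoSetting.modelχ p).Kdd)ˣ ≃* (↥(MuTwoSetting.modelχ p).Kdd)ˣ),
      Thm110DeltaInduced H δ ∧ Thm110DeltaCompat (Mα := MuTwoSetting.modelχ p) (Mβ := MuTwoSetting.modelχ p) δ ∧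
      ∃ σ σ' : (MuTwoSetting.modelχ p).PiTemp,
        (MuTwoSetting.modelχ p).inclX σ ∈ (MuTwoSetting.modelχ p).dotX (epsZχ p) ∧
        (MuTwoSetting.modelχ p).inclX σ' ∈ (MuTwoSetting.modelχ p).dotX (epsZχ p) ∧
        (((anchoredStandardDataχ p hp η).tau.Dpt.map H.γX.toMulEquiv.toMonoidHom =
            (anchoredStandardDataχ p hp η).tau.Dpt.map (MulAut.conj σ).toMonoidHom ∧
          (anchoredStandardDataχ p hp η).tauInv.Dpt.map H.γX.toMulEquiv.toMonoidHom =
            (anchoredStandardDataχ p hp η).tauInv.Dpt.map (MulAut.conj σ').toMonoidHom) ∨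
         ((anchoredStandardDataχ p hp η).tau.Dpt.map H.γX.toMulEquiv.toMonoidHom =
            (anchoredStandardDataχ p hp η).tauInv.Dpt.map (MulAut.conj σ).toMonoidHom ∧
          (anchoredStandardDataχ p hp η).tauInv.Dpt.map H.γX.toMulEquiv.toMonoidHom =
            (anchoredStandardDataχ p hp η).tau.Dpt.map (MulAut.conj σ').toMonoidHom)) :=
  (MuTwoSetting.modelχ p).thm110i_inputs_refl (MuTwoSetting.modelχ_isAdmissibleEpsZ p) (MuTwoSetting.modelχ_compat p)
    (etaleThetaDataχM p η) (anchoredStandardDataχ p hp η)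

/-- **[EtTh] Thm. 1.10 (i) and (ii) HOLD AT THE χ-MODEL for `γ = id`** (`p ≡ 1 (mod 4)`, any class `η̈` playing `η̈^Θ`):
at `M := MuTwoSetting.modelχ p`, `E := etaleThetaDataχSec p η`, the anchored standard datum `anchoredStandardDataχ`
and `Prop15ii` as a THEOREM (abc-iut-L6-d5's `prop15ii_kummerDataχSec`), there is `H : Thm110Hypothesis …` with
`Thm110i H A A ∧ Thm110ii H A A` — the K2 closers p429827 / p430193 INHABITED at a NAMED Kummer-carrying datum, i.e.
the instance forms of F-0512 / F-0514 are NON-VACUOUSLY satisfiable. [cite: MochizukiEtTh2009, Thm 1.10 (i) p.29] -/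
theorem modelχ_thm110i_and_ii (hp : p % 4 = 1)
    (η : (ThetaSetting.modelχ p).H1 (ThetaSetting.modelχ p).GtpYdd) :
    ∃ H : Thm110Hypothesis (Mα := MuTwoSetting.modelχ p) (Mβ := MuTwoSetting.modelχ p) (epsZχ p) (epsZχ p)
        (MuTwoSetting.modelχ_compat p) (MuTwoSetting.modelχ_compat p)
        (etaleThetaDataχM p η) (etaleThetaDataχM p η) (ContinuousMulEquiv.refl _),
      Thm110i H (anchoredStandardDataχ p hp η).toStandardData (anchoredStandardDataχ p hp η).toStandardData ∧
        Thm110ii H (anchoredStandardDataχ p hp η).toStandardData (anchoredStandardDataχ p hp η).toStandardData :=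
  (MuTwoSetting.modelχ p).thm110i_and_ii_refl (MuTwoSetting.modelχ_isAdmissibleEpsZ p) (MuTwoSetting.modelχ_compat p)
    (etaleThetaDataχM p η) (anchoredStandardDataχ p hp η) (prop15ii_etaleThetaDataχSec p η)

/-- The same at abc-iut-L2-d1's GENUINE theta class `η̈^Θ := etaDdχ p` of the χ-model (`SettingModelChiThetaCocycle`).
[cite: MochizukiEtTh2009, Thm 1.10 (ii) p.30] -/
theorem modelχ_thm110i_and_ii_etaDdχ (hp : p % 4 = 1) :
    ∃ H : Thm110Hypothesis (Mα := MuTwoSetting.modelχ p) (Mβ := MuTwoSetting.modelχ p) (epsZχ p) (epsZχ p)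
        (MuTwoSetting.modelχ_compat p) (MuTwoSetting.modelχ_compat p)
        (etaleThetaDataχM p (etaDdχ p)) (etaleThetaDataχM p (etaDdχ p)) (ContinuousMulEquiv.refl _),
      Thm110i H (anchoredStandardDataχ p hp (etaDdχ p)).toStandardData
          (anchoredStandardDataχ p hp (etaDdχ p)).toStandardData ∧
        Thm110ii H (anchoredStandardDataχ p hp (etaDdχ p)).toStandardData
          (anchoredStandardDataχ p hp (etaDdχ p)).toStandardData :=
  modelχ_thm110i_and_ii p hp (etaDdχ p)

/-- **JOINT SATISFIABILITY of the K2 data with their conclusion (census headline).** For `p ≡ 1 (mod 4)` there are a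
Def. 1.7 setting `M` satisfying the guard `IsEtThOrigin`, an admissible `ε_Z`, `hC : Compat`, étale-theta data `E`
whose class is NON-TRIVIAL (`E.etaDd ≠ 1`), an ANCHORED standard datum `A`, `Prop15ii E.toKummerData hC`, and
`H : Thm110Hypothesis ε_Z ε_Z hC hC E E (refl)` such that `Thm110i H A A ∧ Thm110ii H A A` — witness the χ-model with
abc-iut-L2-d1's `etaDdχ`. [cite: MochizukiEtTh2009, Thm 1.10 p.29] -/
theorem _root_.Literature.AnabelianGeometry.EtaleTheta.MuTwoSetting.exists_kummer_model_thm110i_and_ii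
    (hp : p % 4 = 1) :
    ∃ (M : MuTwoSetting p) (εZ : M.GtpC) (_ : M.IsAdmissibleEpsZ εZ) (hC : M.toThetaSetting.Compat)
      (E : M.toThetaSetting.EtaleThetaData) (A : M.AnchoredStandardData E.toKummerData)
      (_ : ThetaSetting.Prop15ii E.toKummerData hC)
      (H : Thm110Hypothesis εZ εZ hC hC E E (ContinuousMulEquiv.refl (M.dotC εZ))),
      M.toThetaSetting.IsEtThOrigin ∧ E.etaDd ≠ 1 ∧
        Thm110i H A.toStandardData A.toStandardData ∧ Thm110ii H A.toStandardData A.toStandardData := by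
  obtain ⟨H, h1, h2⟩ := modelχ_thm110i_and_ii_etaDdχ p hp
  exact ⟨MuTwoSetting.modelχ p, epsZχ p, MuTwoSetting.modelχ_isAdmissibleEpsZ p, MuTwoSetting.modelχ_compat p,
    etaleThetaDataχM p (etaDdχ p), anchoredStandardDataχ p hp (etaDdχ p), prop15ii_etaleThetaDataχSec p (etaDdχ p), H,
    MuTwoSetting.modelχ_isEtThOrigin p, etaDdχ_ne_one p, h1, h2⟩

end Literature.AnabelianGeometry.EtaleTheta.SettingModel

end
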